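import Summits.CriticalPhenomena.PercolationContinuityZ3.Theorems.Transplant.ProdZ2SqShadow
import Summits.CriticalPhenomena.PercolationContinuityZ3.Theorems.Transplant.ProdZ2Paths
import Summits.CriticalPhenomena.PercolationContinuityZ3.Theorems.Transplant.BccClawXLegs
import Summits.CriticalPhenomena.PercolationContinuityZ3.Theorems.Transplant.BccSlabHubRoute
import HarnessLib

/-!
# `F □ ℤ²`, p205010-free routing III: THE HUB TEMPLATE — a swap pair of routings from a PLANAR CLAW of the kernel table «BccClawXTable*» and a FORK of `F`
# (three fibre levels over the hub column; every finite connected `F` with a vertex of degree `≥ 2`)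

builds on p205010 (kernel theorem, internal audit signed; external expert review pending) — NOT used in this file.
Lane `prim-bschramm`, seat `prim-bschramm-p2` (gen 50; class C1b, METHOD = input substitution; memo `HOME/bschramm/P2-LATTICES.md` §161); helper file
(`--supports stmt-CriticalPhenomena-4575 --as helper`).

THE TEMPLATE.  Terminals `E₁ = (g₁, a₁)`, `E₂ = (g₂, a₂)`, `w' = (g₃, a₃)` over target columns; the kernel table gives a hub column `Q` and planar legs
`l₁ : P₁ ⇝ a₁`, `l₂ : P₂ ⇝ a₂` (rerouting region) and `l₃ : P₃ ⇝ a₃` (cleared region) from three neighbours of `Q`, pairwise COLUMN-disjoint (but for the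
shared end when `a₁ = a₂`); a fork `a₀ ∼ c₀ ∼ b₀` of `F` gives the three hub vertices `c = (c₀, Q)`, `u = (a₀, Q)`, `v = (b₀, Q)`.  Routing 1: the chain
`E₁ ⇜ A ⇜ c → u → B ⇝ E₂` with `A = c · l₁` at level `c₀`, `B = l₂` at level `a₀`, and the branch `v · C`, `C = l₃` at level `b₀`; routing 2: the same with the
levels `a₀ ↔ b₀` of `B`, `C` exchanged and `u ↔ v` — a SWAP PAIR («BccSlabHubRoute».`VRouteData.exists_of_hub` twice).  Each lifted leg descends to its
terminal's level through an `F`-path over its LAST-BUT-ONE column («ProdZ2Paths».`exists_liftLeg`), so column-disjointness of the planar legs is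
vertex-disjointness of the lifted ones, WHATEVER `F` is.
* §1 `leg_gpath` (a leg of the model as a planar `GPath` of `Site 2`), `mem_map_pt_iff`;
* §2 **`FinProdZ2.swapPair_of_clawProps`**.
[cite: DuminilCopinSidoraviciusTassion2016, §2.3 (proof of Fact 2: the three disjoint self-avoiding paths γ_u, γ_v, γ_w in B̄_R(z))]
-/

noncomputable section

namespace Summit.CriticalPhenomena.PercolationContinuityZ3.Theorems.Transplant

namespace FinProdZ2

open Literature.Probability.Percolation Literature.Probability.LatticeModels SimpleGraph BccClawX
open scoped Classical

variable {W : Type} (F : SimpleGraph W)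

/-! ## §1 Legs of the model as planar paths -/

omit F in
/-- Membership in a translated leg: `w ∈ l.map (pt z) ↔ rel z w ∈ l`. [folklore] -/
theorem mem_map_pt_iff {z : Site 2} {l : List Pt} {w : Site 2} : w ∈ l.map (pt z) ↔ rel z w ∈ l := by
  constructor
  · intro h
    obtain ⟨p, hp, rfl⟩ := List.mem_map.1 h
    rwa [rel_pt]
  · intro h
    exact List.mem_map.2 ⟨rel z w, h, pt_rel z w⟩

omit F in
/-- **A leg of the model as a planar self-avoiding path of `Site 2`** (from the port next to the hub to the target), with `≥ 2` columns, inside its region,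
off the hub column, its port adjacent to the hub. [folklore] -/
theorem leg_gpath {R : Pt → Bool} {avoid : List Pt} {q a : Pt} {l : List Pt} (h : LegProps R avoid q a l) (z : Site 2) :
    GPath (zdGraph 2) (l.map (pt z)) (pt z (l.head h.ne_nil)) (pt z a) ∧ 2 ≤ (l.map (pt z)).length ∧
      (∀ w ∈ l.map (pt z), R (rel z w) = true) ∧ pt z q ∉ l.map (pt z) ∧ (zdGraph 2).Adj (pt z q) (pt z (l.head h.ne_nil)) := by
  obtain ⟨hne, hc, hnd, hlen, hends, hR, hq, -, hadj⟩ := BccSlab.leg_site h z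
  obtain ⟨hhead, hlast⟩ := hends hne
  refine ⟨⟨hne, hc, hnd, ?_, ?_⟩, hlen, hR, hq, hadj⟩
  · rw [List.head?_eq_some_head hne, hhead]
  · rw [List.getLast?_eq_some_getLast hne, hlast]

/-! ## §2 From a planar claw and a fork to a swap pair -/

/-- **FROM A PLANAR CLAW AND A FORK TO A SWAP PAIR** (every connected `F`): hub vertices `c = (c₀, Q)`, `u = (a₀, Q)`, `v = (b₀, Q)` over the hub column `Q`
for a fork `a₀ ∼ c₀ ∼ b₀`; leg `A = c · l₁` at level `c₀` to `E₁`, legs `B = l₂`, `C = l₃` at levels `a₀`, `b₀` (routing 1) resp. `b₀`, `a₀` (routing 2) to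
`E₂`, `w'`, each descending over its last-but-one column; column-disjointness of the planar legs gives vertex-disjointness, the regions give the cleared-set
conditions. [cite: DuminilCopinSidoraviciusTassion2016, §2.3 (proof of Fact 2: the three disjoint paths in B̄_R(z))] -/
theorem swapPair_of_clawProps [Fintype W] (hF : F.Connected) {c₀ a₀ b₀ : W} (φ : Fork F c₀ a₀ b₀) {z : Site 2} {tR tD sR sD : ℕ}
    {E₁ E₂ w' : W × Site 2} (hne : E₁ ≠ E₂) {q : Pt} {l1 l2 l3 : List Pt}
    (hP : ClawProps (min tR 3) (min tD 4) (min sR 3) (min sD 4) (rel z (sh E₁)) (rel z (sh E₂)) (rel z (sh w')) q l1 l2 l3) :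
    ∃ r₁ r₂ : VRouteData (F □ zdGraph 2) (clearedSet z tD sD ∩ (sqShadow F).lift (sqBlkR 3 z tR sR)) (clearedSet z tD sD) E₁ E₂ w',
      r₁.y = r₂.b ∧ r₁.b = r₂.y := by
  -- the hub column and the three hub vertices
  set Q : Site 2 := pt z q with hQ
  set c : W × Site 2 := (c₀, Q) with hc
  set u : W × Site 2 := (a₀, Q) with hu
  set v : W × Site 2 := (b₀, Q) with hv
  have hcu : (F □ zdGraph 2).Adj c u := by rw [boxProd_adj]; exact Or.inl ⟨φ.hca, rfl⟩
  have hcv : (F □ zdGraph 2).Adj c v := by rw [boxProd_adj]; exact Or.inl ⟨φ.hcb, rfl⟩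
  have huv : u ≠ v := fun e => φ.hab (Prod.mk.inj e).1
  -- the planar legs
  obtain ⟨hG1, hlen1, hR1, hq1, hadj1⟩ := leg_gpath hP.leg1 z
  obtain ⟨hG2, hlen2, hR2, hq2, hadj2⟩ := leg_gpath hP.leg2 z
  obtain ⟨hG3, hlen3, hR3, hq3, hadj3⟩ := leg_gpath hP.leg3 z
  rw [pt_rel] at hG1 hG2 hG3
  rw [← hQ] at hq1 hq2 hq3 hadj1 hadj2 hadj3
  set P₁ : Site 2 := pt z (l1.head hP.leg1.ne_nil) with hP₁
  set P₂ : Site 2 := pt z (l2.head hP.leg2.ne_nil) with hP₂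
  set P₃ : Site 2 := pt z (l3.head hP.leg3.ne_nil) with hP₃
  -- cleared-set conditions by column
  have hWR : ∀ x : W × Site 2, inRPp (min tR 3) (min tD 4) (min sR 3) (min sD 4) (rel z (sh x)) = true →
      x ∈ clearedSet (W := W) z tD sD ∩ (sqShadow F).lift (sqBlkR 3 z tR sR) := by
    intro x hx
    obtain ⟨hD, hRb⟩ := inRPp_rel_iff.1 hx
    exact ⟨hD, by rw [SqShadow.mem_lift, sqShadow_sh]; exact hRb⟩
  have hqW : inRPp (min tR 3) (min tD 4) (min sR 3) (min sD 4) (rel z Q) = true := by rw [hQ, rel_pt]; exact hP.hq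
  have hcW := hWR c (by rw [hc, sh_mk]; exact hqW)
  have huW := hWR u (by rw [hu, sh_mk]; exact hqW)
  have hvW := hWR v (by rw [hv, sh_mk]; exact hqW)
  -- leg A : c ⇝ E₁ (the lifted `l₁` at level `c₀`, prefixed by the hub vertex)
  obtain ⟨LA', n₁, hGA', -, -, hcolA, hendA, -⟩ := exists_liftLeg F hF hG1 hlen1 c₀ E₁.1
  rw [show (E₁.1, sh E₁) = E₁ from rfl] at hGA' hendA
  have hcA' : c ∉ LA' := fun h => hq1 (hcolA c h)
  have hGA : GPath (F □ zdGraph 2) (c :: LA') c E₁ :=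
    hGA'.cons (by rw [boxProd_adj]; exact Or.inr ⟨hadj1, rfl⟩) hcA'
  have hAW : ∀ x ∈ c :: LA', x ∈ clearedSet (W := W) z tD sD ∩ (sqShadow F).lift (sqBlkR 3 z tR sR) := by
    intro x hx
    rcases List.mem_cons.1 hx with rfl | hx
    · exact hcW
    · exact hWR x (hR1 _ (hcolA x hx))
  -- the two versions of legs B and C
  have legB : ∀ x₀ : W, ∃ LB : List (W × Site 2), GPath (F □ zdGraph 2) LB (x₀, P₂) E₂ ∧ (∀ x ∈ LB, sh x ∈ l2.map (pt z)) ∧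
      (∀ x ∈ LB, sh x = sh E₂ → x = E₂) ∧ (∀ x ∈ LB, x ∈ clearedSet (W := W) z tD sD ∩ (sqShadow F).lift (sqBlkR 3 z tR sR)) := by
    intro x₀
    obtain ⟨LB, n₂, hGB, -, -, hcolB, hendB, -⟩ := exists_liftLeg F hF hG2 hlen2 x₀ E₂.1
    rw [show (E₂.1, sh E₂) = E₂ from rfl] at hGB hendB
    exact ⟨LB, hGB, hcolB, hendB, fun x hx => hWR x (hR2 _ (hcolB x hx))⟩
  have legC : ∀ x₀ : W, ∃ LC : List (W × Site 2), GPath (F □ zdGraph 2) LC (x₀, P₃) w' ∧ (∀ x ∈ LC, sh x ∈ l3.map (pt z)) ∧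
      (∀ x ∈ LC, x ∈ clearedSet (W := W) z tD sD) := by
    intro x₀
    obtain ⟨LC, n₃, hGC, -, -, hcolC, -, -⟩ := exists_liftLeg F hF hG3 hlen3 x₀ w'.1
    rw [show (w'.1, sh w') = w' from rfl] at hGC
    exact ⟨LC, hGC, hcolC, fun x hx => inDp_rel_iff.1 (hR3 _ (hcolC x hx))⟩
  -- disjointness, by columns
  have hAB : ∀ (LB : List (W × Site 2)), (∀ x ∈ LB, sh x ∈ l2.map (pt z)) → (∀ x ∈ LB, sh x = sh E₂ → x = E₂) → ∀ x ∈ c :: LA', x ∉ LB := by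
    intro LB hcolB hendB x hxA hxB
    rcases List.mem_cons.1 hxA with rfl | hxA
    · exact hq2 (hcolB c hxB)
    · have h1 := mem_map_pt_iff.1 (hcolA x hxA)
      have h2 := mem_map_pt_iff.1 (hcolB x hxB)
      obtain ⟨heq, hx1⟩ := hP.d12 _ h1 h2
      have hx1' : sh x = sh E₁ := by have e := congrArg (pt z) hx1; rwa [pt_rel, pt_rel] at e
      have heq' : sh E₁ = sh E₂ := by have e := congrArg (pt z) heq; rwa [pt_rel, pt_rel] at e
      exact hne ((hendA x hxA hx1').symm.trans (hendB x hxB (hx1'.trans heq')))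
  have hAC : ∀ (LC : List (W × Site 2)), (∀ x ∈ LC, sh x ∈ l3.map (pt z)) → ∀ x ∈ c :: LA', x ∉ LC := by
    intro LC hcolC x hxA hxC
    rcases List.mem_cons.1 hxA with rfl | hxA
    · exact hq3 (hcolC c hxC)
    · exact hP.d31 _ (mem_map_pt_iff.1 (hcolC x hxC)) (mem_map_pt_iff.1 (hcolA x hxA))
  have hBC : ∀ (LB LC : List (W × Site 2)), (∀ x ∈ LB, sh x ∈ l2.map (pt z)) → (∀ x ∈ LC, sh x ∈ l3.map (pt z)) → ∀ x ∈ LB, x ∉ LC := by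
    intro LB LC hcolB hcolC x hxB hxC
    exact hP.d32 _ (mem_map_pt_iff.1 (hcolC x hxC)) (mem_map_pt_iff.1 (hcolB x hxB))
  -- the hub vertices are off the legs (their column is the hub column)
  have hoffA : ∀ y₀ : W, y₀ ≠ c₀ → (y₀, Q) ∉ c :: LA' := by
    intro y₀ hy h
    rcases List.mem_cons.1 h with h | h
    · exact hy (Prod.mk.inj h).1
    · exact hq1 (hcolA _ h)
  have hoffB : ∀ (y₀ : W) (LB : List (W × Site 2)), (∀ x ∈ LB, sh x ∈ l2.map (pt z)) → (y₀, Q) ∉ LB :=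
    fun y₀ LB hcolB h => hq2 (hcolB _ h)
  have hoffC : ∀ (y₀ : W) (LC : List (W × Site 2)), (∀ x ∈ LC, sh x ∈ l3.map (pt z)) → (y₀, Q) ∉ LC :=
    fun y₀ LC hcolC h => hq3 (hcolC _ h)
  -- the ports are adjacent to the hub vertices of their level
  have hportB : ∀ x₀ : W, (F □ zdGraph 2).Adj (x₀, Q) (x₀, P₂) := fun x₀ => by rw [boxProd_adj]; exact Or.inr ⟨hadj2, rfl⟩
  have hportC : ∀ x₀ : W, (F □ zdGraph 2).Adj (x₀, Q) (x₀, P₃) := fun x₀ => by rw [boxProd_adj]; exact Or.inr ⟨hadj3, rfl⟩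
  -- routing 1: B at level a₀, C at level b₀; routing 2: B at level b₀, C at level a₀
  obtain ⟨LB₁, hGB₁, hcolB₁, hendB₁, hBW₁⟩ := legB a₀
  obtain ⟨LC₁, hGC₁, hcolC₁, hCW₁⟩ := legC b₀
  obtain ⟨LB₂, hGB₂, hcolB₂, hendB₂, hBW₂⟩ := legB b₀
  obtain ⟨LC₂, hGC₂, hcolC₂, hCW₂⟩ := legC a₀
  obtain ⟨r₁, h1y, h1b⟩ := VRouteData.exists_of_hub hGA hGB₁ hGC₁ hne hAW hBW₁ hCW₁ huW hvW.1 hcu hcv (hportB a₀) (hportC b₀) huv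
    (hAB LB₁ hcolB₁ hendB₁) (hAC LC₁ hcolC₁) (hBC LB₁ LC₁ hcolB₁ hcolC₁)
    (hoffA a₀ φ.ne₁.symm) (hoffB a₀ LB₁ hcolB₁) (hoffC a₀ LC₁ hcolC₁) (hoffA b₀ φ.ne₂.symm) (hoffB b₀ LB₁ hcolB₁) (hoffC b₀ LC₁ hcolC₁)
  obtain ⟨r₂, h2y, h2b⟩ := VRouteData.exists_of_hub hGA hGB₂ hGC₂ hne hAW hBW₂ hCW₂ hvW huW.1 hcv hcu (hportB b₀) (hportC a₀) huv.symm
    (hAB LB₂ hcolB₂ hendB₂) (hAC LC₂ hcolC₂) (hBC LB₂ LC₂ hcolB₂ hcolC₂)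
    (hoffA b₀ φ.ne₂.symm) (hoffB b₀ LB₂ hcolB₂) (hoffC b₀ LC₂ hcolC₂) (hoffA a₀ φ.ne₁.symm) (hoffB a₀ LB₂ hcolB₂) (hoffC a₀ LC₂ hcolC₂)
  exact ⟨r₁, r₂, by rw [h1y, h2b], by rw [h1b, h2y]⟩

end FinProdZ2

end Summit.CriticalPhenomena.PercolationContinuityZ3.Theorems.Transplant

end
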